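import Summits.NavierStokesRegularity.NavierStokesRegularity.Theses.PalasekTowerBreakdown
import Summits.NavierStokesRegularity.FluidComputer.PalasekTowerRegisterGlobalBase
import Summits.NavierStokesRegularity.FluidComputer.PalasekTowerRegisterGlobalDesignExact
import Summits.NavierStokesRegularity.FluidComputer.PalasekTowerHeredityWitnessUnconditionalRungs

/-!
# NavierStokesRegularity — route `PalasekTowerBreakdown`, crux `EpisodeBase`: the base line WITH HOST PREPARATION DISCHARGED, by name

Supports `stmt-NavierStokesRegularity-19179` (`PalasekTowerBreakdown.EpisodeBase`, unfolding to K1G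
`EpisodeBaseG` = `RungG 1`; it does NOT close it). Cell `ns-blowup`, seat `ns-blowup-ecbridge-3` (g2),
D-0074 GROUP C «BRIDGE SUPPORT». LABEL: E–C typing (pure glue over landed register theorems). WHAT THIS
IS NOT: not NS — no stage, flow or tower is constructed here; every theorem below has an OPEN typed
`Prop` as hypothesis or states an equivalence; nothing is asserted about NS dynamics or blow-up.

The registered BC3 line of the crux (`Cruxes/EpisodeBase/Lines/birth.lean`) is
`EpisodeBase_of : HostPreparation → FirstEpisodeR → PalasekTowerBreakdown.EpisodeBase`. Its FIRST stub,
host preparation (= `RungG 0`), is a TREE THEOREM since p428335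
(`…PalasekTowerClayBridge.Host.hostPreparation` / `Host.rungG_zero`, the ten-file host series of this
seat's g0 — a PRESCRIBED level-`0` host; the route file imports it since rev 11 and its tribunal fit
names `Host.rungG_zero` as witness, rev 12). This file records, against the ROUTE DECL by name, what the
crux's cone looks like with that stub discharged — ONE typed hypothesis each, no uniqueness fact (W14 is
itself proved, item 19180, but is not even needed here):

* `palasekTowerBreakdown_episodeBase_of_heredityWitness_zero : HeredityWitness 0 → EpisodeBase` — the
  WITNESS DOOR of record (seat ecbridge-6: a typed numerical-witness hypothesis at level `0` that MODEL
  tower words can be compared with but never instantiate) now closes the crux ALONE;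
* `palasekTowerBreakdown_episodeBase_of_firstEpisodeR : FirstEpisodeR → EpisodeBase` — the registered
  line's own composition with its first stub discharged (what a re-registered v3 skeleton reads; the
  remaining stub `FirstEpisodeR` is WITHDRAWN as a target — refuter K53: its `∀` ranges over junk hosts
  such as the decaying host of record — and stays a named trap);
* `palasekTowerBreakdown_episodeBase_of_firstEpisode : FirstEpisode → EpisodeBase` and
  `…_of_firstEpisodeAll : FirstEpisodeAll → EpisodeBase` — the v1 skeleton's universal stub
  (`= HeredityAt 0`) and the design-free re-push form, same status (named traps, planner RULING l.1890);
* `palasekTowerBreakdown_episodeBase_iff_exists_exact` / `…_of_exact` — the SPLIT SHAPE OF RECORD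
  (planner AMENDMENT STATUS l.2543, ecbridge-4 p424500): `EpisodeBase ↔ ∃ S₀, HostPreparationD (exact S₀)
  ∧ FirstEpisodeD (exact S₀)`; its first child is inhabited for the host family of record (ecbridge-4
  p431242 `Host.exists_hostPreparationD_exact`), its second child for a NAMED level-`1`-growing design
  `S*` is the live content of the item (R2);
* `palasekTowerBreakdown_hostPreparation_of_episodeBase : EpisodeBase → HostPreparation` — the free
  direction (host preparation is a truncation of K1G), for the record.

HONEST NOTE: none of this moves the mathematics of the first episode (`RungG 1`: one forced classical
finite-energy Navier–Stokes flow whose free dynamics doubles its maximal speed, `Y₀ ≈ 1351 → Y₁ ≈ 2778`,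
and forms the level-`1` strain floor `A₁ ≈ 1.24·10⁶` and the `N₁`-core inside the window
`w₀ = c₅ log N₁ / A₀ ≈ 1.8·10⁻⁴` at unit viscosity, the admissible push moving velocities by `≤ 1/4`);
it only removes the prepared-host hypothesis from every door by name.

References: S. Palasek, arXiv:2605.13827 §3.3–§4 [cite: Palasek2026ElementaryModel, §4]; H. Sohr,
*The Navier–Stokes Equations* (2001), Ch. V Thm. 1.5.1 [cite: Sohr2001, Ch. V Thm. 1.5.1].
-/

-- `Summit.<Summit>.<Problem>` is the tree's mandated summit-side namespace (CONVENTIONS §2); for this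
-- single-conjunct summit the two coincide, so the duplicate is deliberate.
set_option linter.dupNamespace false

namespace Summit.NavierStokesRegularity.NavierStokesRegularity.Theorems

open Summit.NavierStokesRegularity.NavierStokesRegularity.Theses
open Summit.NavierStokesRegularity.FluidComputer.PalasekTowerClayBridge

/-- **THE WITNESS DOOR CLOSES THE CRUX ALONE**: a heredity witness at level `0` (for every pinned rigid
quiet schedule with a registered host, its own classical finite-energy flow reaches `τ₁` inside the
level-`1` ceiling and shows the three level-`1` floors at `τ₁`) gives `PalasekTowerBreakdown.EpisodeBase`
— host preparation (`RungG 0`) is discharged by `Host.rungG_zero` (p428335), and no uniqueness fact is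
used (`episodeBaseG_of_rungG_zero_of_heredityWitness'`, p423427). [cite: Sohr2001, Ch. V Thm. 1.5.1] -/
theorem palasekTowerBreakdown_episodeBase_of_heredityWitness_zero (h : HeredityWitness 0) :
    PalasekTowerBreakdown.EpisodeBase := by
  unfold PalasekTowerBreakdown.EpisodeBase
  exact episodeBaseG_of_rungG_zero_of_heredityWitness' Host.rungG_zero h

/-- **The registered line's composition with its first stub discharged**: the re-forcing first episode
`FirstEpisodeR` (registered stub `stub_first_episodeR`; WITHDRAWN as a target, K53 — a named trap whose
`∀` includes the decaying host of record) alone gives the crux by name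
(`episodeBaseG_of_host_firstR` at `Host.hostPreparation`). [cite: Palasek2026ElementaryModel, §4] -/
theorem palasekTowerBreakdown_episodeBase_of_firstEpisodeR (h : FirstEpisodeR) :
    PalasekTowerBreakdown.EpisodeBase := by
  unfold PalasekTowerBreakdown.EpisodeBase
  exact episodeBaseG_of_host_firstR Host.hostPreparation h

/-- **The v1 skeleton's composition with host preparation discharged**: the universal first episode
`FirstEpisode` (`= HeredityAt 0`; a named trap, planner RULING STATUS l.1890) alone gives the crux by
name. [cite: Palasek2026ElementaryModel, §4] -/
theorem palasekTowerBreakdown_episodeBase_of_firstEpisode (h : FirstEpisode) :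
    PalasekTowerBreakdown.EpisodeBase := by
  unfold PalasekTowerBreakdown.EpisodeBase
  exact Host.episodeBaseG_of_firstEpisode h

/-- **The design-free re-push form with host preparation discharged**: `FirstEpisodeAll`
(`= FirstEpisodeD HostClass.any`, the ∀-hosts trap by name, ecbridge-4 p418872) alone gives the crux by
name. [cite: Palasek2026ElementaryModel, §4] -/
theorem palasekTowerBreakdown_episodeBase_of_firstEpisodeAll (h : FirstEpisodeAll) :
    PalasekTowerBreakdown.EpisodeBase := by
  unfold PalasekTowerBreakdown.EpisodeBase
  exact episodeBaseG_of_rungG_zero_firstAll Host.rungG_zero h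

/-- **THE SPLIT SHAPE OF RECORD, by name** (planner AMENDMENT STATUS l.2543; ecbridge-4
`episodeBaseG_iff_exists_exact`, p424500): the crux is EQUIVALENT to «some NAMED design `S₀` carries
both children over its singleton class» — host preparation in `HostClass.exact S₀` and the first
episode over `HostClass.exact S₀`; no hypothesis. [cite: Sohr2001, Ch. V Thm. 1.5.1] -/
theorem palasekTowerBreakdown_episodeBase_iff_exists_exact :
    PalasekTowerBreakdown.EpisodeBase ↔ ∃ S₀ : Schedule TowerRates.wide,
      HostPreparationD (HostClass.exact S₀) ∧ FirstEpisodeD (HostClass.exact S₀) := by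
  unfold PalasekTowerBreakdown.EpisodeBase
  exact episodeBaseG_iff_exists_exact

/-- **The glue of the split shape of record, by name**: for a named design `S₀`, the two children over
its singleton class give the crux (explicit binders in the order
`HostPreparationD (exact S₀) → FirstEpisodeD (exact S₀) → EpisodeBase`). [folklore] -/
theorem palasekTowerBreakdown_episodeBase_of_exact (S₀ : Schedule TowerRates.wide)
    (hH : HostPreparationD (HostClass.exact S₀)) (hF : FirstEpisodeD (HostClass.exact S₀)) :
    PalasekTowerBreakdown.EpisodeBase := by
  unfold PalasekTowerBreakdown.EpisodeBase
  exact episodeBaseG_of_exact S₀ hH hF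

/-- **The free direction, for the record**: the crux contains host preparation (a level-`1` stage
restricts to a level-`0` stage of the same schedule; `EpisodeBaseG.hostPreparation`). [folklore] -/
theorem palasekTowerBreakdown_hostPreparation_of_episodeBase (h : PalasekTowerBreakdown.EpisodeBase) :
    HostPreparation := by
  unfold PalasekTowerBreakdown.EpisodeBase at h
  exact h.hostPreparation

/-! ## §2 Honest reading of §1's first door (appended by the same seat, same day)

`HeredityWitness 0` is the `∀`-DESIGN form: EVERY pinned rigid quiet design with a registered host has a
level witness at level `0`. It is the SAME statement as the universal first episode —
`HeredityWitness 0 ↔ HeredityAt 0 ↔ FirstEpisode` (`heredityAt_zero_iff_heredityWitness_zero`, p423427;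
`firstEpisode_iff_heredityAt_zero`, `Iff.rfl`) — so its hypothesis class contains the host of record,
whose designed continuation DECAYS: `palasekTowerBreakdown_episodeBase_of_heredityWitness_zero` is a door
through a NAMED TRAP, exactly like `…_of_firstEpisode` / `…_of_firstEpisodeR` / `…_of_firstEpisodeAll`,
and must not be read as «one certificate closes the crux». The certificate-shaped doors are the
`∃`-forms: `palasekTowerBreakdown_episodeBase_iff_exists_levelWitness_zero` (ecbridge-6, p427615: ONE
prepared design with ITS OWN level-`0` witness) and §1's `palasekTowerBreakdown_episodeBase_iff_exists_exact`
(ONE named design carrying both children over its singleton class). -/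

/-- **The two universal first-episode forms coincide**: the heredity witness at level `0` IS the
∀-schedule first episode (`HeredityWitness 0 ↔ HeredityAt 0`, p423427, and `FirstEpisode = HeredityAt 0`
definitionally) — one named trap, two names. [cite: Sohr2001, Ch. V Thm. 1.5.1] -/
theorem palasekTowerBreakdown_heredityWitness_zero_iff_firstEpisode : HeredityWitness 0 ↔ FirstEpisode :=
  heredityAt_zero_iff_heredityWitness_zero.symm.trans firstEpisode_iff_heredityAt_zero.symm

end Summit.NavierStokesRegularity.NavierStokesRegularity.Theorems
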